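import Summits.QuantumFields.YangMills.Theorems.LuscherReductionDressedRitzLiftLeakageKinematic
import Summits.QuantumFields.YangMills.Theorems.LuscherReductionDressedRitzLiftLeakageClusterWidth
import Summits.QuantumFields.YangMills.Theorems.LuscherReductionDressedRitzLiftLeakageDressedStub
import HarnessLib

/-!
# Crux `DressedRitz` (stmt-QuantumFields-20205), line «polyakovlift» r5, stub S-LEAK `stub_liftLeakage` — support XV:
# ★★★ the CLOSING press-button after the kinematic reduction: r5 text ⟸ reference data + (SLOW) + (OUT) + (CW) + (GR) per lattice point

Support module (fleet seat ym-20205-polyakovlift-s1 gen 1; `--supports stmt-QuantumFields-20205`, helper, no closure claim).  Composition of the landed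
chain for the registered stub `Summit.QuantumFields.YangMills.Cruxes.DressedRitz.PolyakovLift.stub_liftLeakage` (skeleton r5, sha16 8b6782afbcc2a19a):
XIV `residual_dressedLiftVec_le_of_slow_outside` (per reference lift: (RL) at the own exact fine level from (SLOW)+(OUT)) → X
`residualLaw_allBases_of_reference_lift_width` (all lift bases, fine clusters of width `δ`, in-level Gram `γ`) → IX∕II `leakageClause_of_residual` → VIII
`leakageClause_iterate_iff` (PF vacuum `Ω` → every raw vacuum `±Ω`).  ONE theorem whose hypothesis is the located renormalisation-group debt and whose
conclusion is the r5 text of `Stmt.stub_liftLeakage` VERBATIM (`LeakageClause k C β (dressedLiftFamily β φ g)` for every raw vacuum and lift basis):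

HYPOTHESIS (per `k`: constants `C ≥ 0`, `lam0 > 0`; eventually in the femto window, at the Perron–Frobenius package `(Ω, θ, c)`), the prover exhibits
* reference ONE-SITE data at `B₁ = liftCoupling β L`: positive raw vacuum `Ω₁`, exact orthonormal eigenfamily `ψ_0 … ψ_{N−1}` (levels `ev n`) dominating at
  `0 ≤ Λ₁ < μ_k(B₁)` (the tree supplies them with window-uniform `N`: `LiftLeak.exists_reference_uniform`, p528897);
* ONE exact FINE eigenfamily `χ_0 … χ_{M−1}` of `K_β` (levels `μ j`) dominating at `Λ ≥ 0` (tree: `LiftLeak.exists_eigenfamily_dominating M`; take `M` with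
  `levelValue M ≤ (own levels)/e`, available since `levelValue M → 0` at fixed lattice);
* per reference `n`: an own fine index `j₀ n` (`Λ ≤ μ(j₀ n) ≤ λ₀`, `(L+1)²Λ^{2L} ≤ μ(j₀ n)^{2L}`) and a slow set `S n` (`μ j ≤ μ(j₀ n)` off `S n`), with, for
  the UNDRESSED reference state `x_n = liftVec β Ω (ψ_n/Ω₁)` and `w₀ = ⟨x_n, χ_{j₀ n}⟩²`:
  (SLOW) `Σ_{j∈S n}(μ_j − μ_{j₀n})²μ_j^{2L}⟨x_n,χ_j⟩² ≤ C₁(λ³/L²)λ₀²·μ_{j₀n}^{2L}·w₀`,  (OUT) `‖x_n‖² − Σ_{j∈S n}⟨x_n,χ_j⟩² ≤ C₂λ³·w₀`;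
* (CW) `(μ_{j₀n} − μ_{j₀n'})² ≤ δ²` whenever `ev n = ev n'`;  (GR) `|⟨v_n,v_{n'}⟩| ≤ γ‖v_n‖‖v_{n'}‖` for `n ≠ n'`, `ev n = ev n'`, `v_n = dressedLiftVec β Ω (ψ_n/Ω₁)`;
* rates: `C₁, C₂, γ ≥ 0`, `Nγ ≤ 1/2`, `4N((C₁+C₂)(λ³/L²)λ₀² + δ²) ≤ C(λ³/L²)λ₀²`.
Everything except (SLOW), (OUT), (CW) for non-doublet same-type degeneracies and (GR) for same-type accidental degeneracies is supplied by the tree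
(V, XI–XIV, XIII); those four are the OPEN estimates (first-order zero-mode band admixtures; `L`-uniform out-of-band weight `O(λ³)`; fine splitting
`O(λ²/L)λ₀` of one-site-degenerate levels).  Not proved here; no claim on the stub.

HONEST FRAMING: quantifier plumbing at fixed lattice on the conditional femto rung R2b1; `stub_liftLeakage` stays OPEN; nothing here bears on infinite
volume, the continuum limit or the Clay gap.
References: M. Lüscher, NPB 219 (1983) 233 [cite: Luscher1983, §3]; M. Lüscher, U. Wolff, NPB 339 (1990) 222 [cite: LuscherWolff1990, §2];
T. Kato, J. Phys. Soc. Japan 4 (1949) 334 [cite: Kato1949, §1]; M. Reed, B. Simon IV (1978) Thm XIII.1, XIII.43 [cite: ReedSimonIV1978].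
-/

set_option autoImplicit false

noncomputable section

open MeasureTheory Filter Topology Finset
open Literature.MathematicalPhysics.QuantumFieldTheory
open Literature.MathematicalPhysics.QuantumLattice
open scoped BigOperators

namespace Summit.QuantumFields.YangMills.Theorems.FemtoTransferGap.LiftLeak

open Summit.QuantumFields.YangMills.Theorems.FemtoTransferGap
open Summit.QuantumFields.YangMills.Theorems.FemtoTransferGap.PolyakovLift
open Summit.QuantumFields.YangMills.Theorems.FemtoTransferGap.VacDict

variable {L : ℕ} [NeZero L]

/-- The dressed lift is linear in the one-site function (finite combinations of physical functions). [folklore] -/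
theorem dressedLiftVec_sum_smul' (β : ℝ) {φ : GaugeConfig 3 L SU2 → ℝ} (hφ : IsPhys φ) {N : ℕ}
    (f : Fin N → (GaugeConfig 3 1 SU2 → ℝ)) (c : Fin N → ℝ) (hf : ∀ n, IsPhys (f n)) :
    dressedLiftVec β φ (fun V => ∑ n, c n * f n V) = ∑ n, c n • dressedLiftVec β φ (f n) :=
  iterate_liftVec_sum_smul β (dressSteps L) hφ hf c

/-- ★★★ **S-LEAK (r5 text VERBATIM) from reference data + (SLOW) + (OUT) + (CW) + (GR) per lattice point** (hypothesis as in the module docstring).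
[cite: Luscher1983, §3] [cite: LuscherWolff1990, §2] [cite: Kato1949, §1] [cite: ReedSimonIV1978, Thm XIII.1] -/
theorem liftLeakage_dressed_of_slowOutsideLaw
    (h : ∀ k : ℕ, ∃ C lam0 : ℝ, 0 ≤ C ∧ 0 < lam0 ∧ ∀ lam : ℝ, 0 < lam → lam ≤ lam0 → ∃ L0 : ℕ,
      ∀ (L : ℕ) [NeZero L], L0 ≤ L → ∀ β : ℝ, InFemtoWindow lam β L →
        ∀ (Ω : physSubmodule L) (θ c : ℝ), IsVacuum β Ω θ → 0 < c → (∀ U, c ≤ (Ω : GaugeConfig 3 L SU2 → ℝ) U) →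
          ∃ (Ω₁ : GaugeConfig 3 1 SU2 → ℝ) (N : ℕ) (ψ : Fin N → (GaugeConfig 3 1 SU2 → ℝ)) (ev : Fin N → ℝ) (Λ₁ : ℝ)
            (M : ℕ) (χ : Fin M → (GaugeConfig 3 L SU2 → ℝ)) (μ : Fin M → ℝ) (Λ : ℝ)
            (j₀ : Fin N → Fin M) (S : Fin N → Finset (Fin M)) (δ γ C₁ C₂ : ℝ),
            -- reference one-site data at `B₁`
            IsRawVacuum (liftCoupling β L) Ω₁ ∧ (∃ c₁ : ℝ, 0 < c₁ ∧ ∀ V, c₁ ≤ Ω₁ V) ∧ (∀ n, IsPhys (ψ n)) ∧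
            (∀ n n', l2 (ψ n) (ψ n') = if n = n' then 1 else 0) ∧ (∀ n, transferApply (liftCoupling β L) (ψ n) = ev n • ψ n) ∧
            0 ≤ Λ₁ ∧ Λ₁ < levelValue su2Rep 1 (liftCoupling β L) k ∧
            (∀ ξ : GaugeConfig 3 1 SU2 → ℝ, IsPhys ξ → (∀ n, l2 ξ (ψ n) = 0) →
              l2 ξ (transferApply (liftCoupling β L) ξ) ≤ Λ₁ * l2 ξ ξ) ∧
            -- one exact fine eigenfamily of `K_β`, dominating at `Λ`
            (∀ j, IsPhys (χ j)) ∧ (∀ j j', l2 (χ j) (χ j') = if j = j' then 1 else 0) ∧ (∀ j, transferApply β (χ j) = μ j • χ j) ∧ 0 ≤ Λ ∧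
            (∀ ξ : GaugeConfig 3 L SU2 → ℝ, IsPhys ξ → (∀ j, l2 ξ (χ j) = 0) → l2 ξ (transferApply β ξ) ≤ Λ * l2 ξ ξ) ∧
            -- rates
            0 ≤ C₁ ∧ 0 ≤ C₂ ∧ 0 ≤ γ ∧ (N : ℝ) * γ ≤ 1 / 2 ∧
            4 * N * ((C₁ + C₂) * (luscherLambda β L ^ 3 / (L : ℝ) ^ 2) * levelValue su2Rep L β 0 ^ 2 + δ ^ 2) ≤
              C * (luscherLambda β L ^ 3 / (L : ℝ) ^ 2) * levelValue su2Rep L β 0 ^ 2 ∧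
            -- per reference vector: own index, slow set, (SLOW), (OUT)
            (∀ n, Λ ≤ μ (j₀ n) ∧ μ (j₀ n) ≤ levelValue su2Rep L β 0 ∧ (∀ j, j ∉ S n → μ j ≤ μ (j₀ n)) ∧
              ((dressSteps L : ℝ) + 1) ^ 2 * Λ ^ (2 * dressSteps L) ≤ μ (j₀ n) ^ (2 * dressSteps L) ∧
              ∑ j ∈ S n, (μ j - μ (j₀ n)) ^ 2 * μ j ^ (2 * dressSteps L) *
                  l2 (liftVec β (Ω : GaugeConfig 3 L SU2 → ℝ) (ψ n / Ω₁)) (χ j) ^ 2 ≤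
                C₁ * (luscherLambda β L ^ 3 / (L : ℝ) ^ 2) * levelValue su2Rep L β 0 ^ 2 *
                  (μ (j₀ n) ^ (2 * dressSteps L) * l2 (liftVec β (Ω : GaugeConfig 3 L SU2 → ℝ) (ψ n / Ω₁)) (χ (j₀ n)) ^ 2) ∧
              l2 (liftVec β (Ω : GaugeConfig 3 L SU2 → ℝ) (ψ n / Ω₁)) (liftVec β (Ω : GaugeConfig 3 L SU2 → ℝ) (ψ n / Ω₁)) -
                  ∑ j ∈ S n, l2 (liftVec β (Ω : GaugeConfig 3 L SU2 → ℝ) (ψ n / Ω₁)) (χ j) ^ 2 ≤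
                C₂ * luscherLambda β L ^ 3 * l2 (liftVec β (Ω : GaugeConfig 3 L SU2 → ℝ) (ψ n / Ω₁)) (χ (j₀ n)) ^ 2) ∧
            -- (CW) fine splitting inside a one-site level, (GR) in-level Gram of the dressed reference lifts
            (∀ n n', ev n = ev n' → (μ (j₀ n) - μ (j₀ n')) ^ 2 ≤ δ ^ 2) ∧
            (∀ n n', n ≠ n' → ev n = ev n' →
              |l2 (dressedLiftVec β (Ω : GaugeConfig 3 L SU2 → ℝ) (ψ n / Ω₁)) (dressedLiftVec β (Ω : GaugeConfig 3 L SU2 → ℝ) (ψ n' / Ω₁))| ≤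
                γ * (Real.sqrt (l2 (dressedLiftVec β (Ω : GaugeConfig 3 L SU2 → ℝ) (ψ n / Ω₁)) (dressedLiftVec β (Ω : GaugeConfig 3 L SU2 → ℝ) (ψ n / Ω₁))) *
                  Real.sqrt (l2 (dressedLiftVec β (Ω : GaugeConfig 3 L SU2 → ℝ) (ψ n' / Ω₁))
                    (dressedLiftVec β (Ω : GaugeConfig 3 L SU2 → ℝ) (ψ n' / Ω₁)))))) :
    ∀ k : ℕ, ∃ C lam0 : ℝ, 0 ≤ C ∧ 0 < lam0 ∧ ∀ lam : ℝ, 0 < lam → lam ≤ lam0 → ∃ L0 : ℕ,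
      ∀ (L : ℕ) [NeZero L], L0 ≤ L → ∀ β : ℝ, InFemtoWindow lam β L →
        ∀ φ : GaugeConfig 3 L SU2 → ℝ, IsRawVacuum β φ →
          ∀ (ω : GaugeConfig 3 1 SU2 → ℝ) (g : Fin k → (GaugeConfig 3 1 SU2 → ℝ)), LiftBasis (liftCoupling β L) k ω g →
            LeakageClause k C β (dressedLiftFamily β φ g) := by
  intro k
  obtain ⟨C, lam0, hC, hlam0, hk⟩ := h k
  refine ⟨C, lam0, hC, hlam0, fun lam hlam hle => ?_⟩
  obtain ⟨L0, hL⟩ := hk lam hlam hle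
  refine ⟨L0, fun L _ hL0 β hW φ hφ ω g hb => ?_⟩
  obtain ⟨Ω, θ, c, hV, hc, hcle⟩ := exists_isVacuum (L := L) β
  obtain ⟨Ω₁, N, ψ, ev, Λ₁, M, χ, μ, Λ, j₀, S, δ, γ, C₁, C₂, hΩ₁, hpos, hψ, hon, heig, hΛ₁, hΛ₁k, hdom₁, hχ, honχ, heigχ, hΛ, hdomχ,
    hC₁, hC₂, hγ, hNγ, hrate, hper, hwidth, hgram⟩ := hL L hL0 β hW Ω θ c hV hc hcle
  have hβ : 0 ≤ β := zero_le_one.trans hW.1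
  have hB : 0 < liftCoupling β L := by
    unfold liftCoupling
    exact div_pos two_pos (pow_pos (luscherLambda_pos_of_window hlam hW) 3)
  have hΩphys : IsPhys (Ω : GaugeConfig 3 L SU2 → ℝ) := hV.raw.1
  obtain ⟨c₁, hc₁, hc₁le⟩ := hpos
  have hG : ∀ n, IsPhys (ψ n / Ω₁) := fun n => OpPlat.isPhys_div (hψ n) hΩ₁.1 hc₁ hc₁le
  set ρ := (C₁ + C₂) * (luscherLambda β L ^ 3 / (L : ℝ) ^ 2) * levelValue su2Rep L β 0 ^ 2 with hρdef
  have hρ : 0 ≤ ρ := mul_nonneg (mul_nonneg (add_nonneg hC₁ hC₂)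
    (div_nonneg (pow_nonneg (by unfold luscherLambda; exact Real.rpow_nonneg (le_max_right _ _) _) 3) (sq_nonneg _))) (sq_nonneg _)
  -- (RL) per reference lift at its own exact fine level, from (SLOW)+(OUT) (XIV)
  have hres : ∀ n, l2 (transferApply β (dressedLiftVec β (Ω : GaugeConfig 3 L SU2 → ℝ) (ψ n / Ω₁)) -
        μ (j₀ n) • dressedLiftVec β (Ω : GaugeConfig 3 L SU2 → ℝ) (ψ n / Ω₁))
      (transferApply β (dressedLiftVec β (Ω : GaugeConfig 3 L SU2 → ℝ) (ψ n / Ω₁)) -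
        μ (j₀ n) • dressedLiftVec β (Ω : GaugeConfig 3 L SU2 → ℝ) (ψ n / Ω₁)) ≤
      ρ * l2 (dressedLiftVec β (Ω : GaugeConfig 3 L SU2 → ℝ) (ψ n / Ω₁)) (dressedLiftVec β (Ω : GaugeConfig 3 L SU2 → ℝ) (ψ n / Ω₁)) := by
    intro n
    obtain ⟨hΛμ, hμtop, hS, hgap, hslow, hout⟩ := hper n
    exact residual_dressedLiftVec_le_of_slow_outside hβ hΩphys (hG n) hχ honχ μ heigχ hΛ hdomχ (j₀ n) hΛμ hμtop (S n) hS hgap hC₁ hC₂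
      hslow hout
  -- all lift bases, width `δ`, Gram `γ` (X)
  have hres_all : ∀ i : Fin k, ∃ a' : ℝ,
      l2 (transferApply β (dressedLiftVec β (Ω : GaugeConfig 3 L SU2 → ℝ) (g i)) - a' • dressedLiftVec β (Ω : GaugeConfig 3 L SU2 → ℝ) (g i))
          (transferApply β (dressedLiftVec β (Ω : GaugeConfig 3 L SU2 → ℝ) (g i)) - a' • dressedLiftVec β (Ω : GaugeConfig 3 L SU2 → ℝ) (g i)) ≤
        C * (luscherLambda β L ^ 3 / (L : ℝ) ^ 2) * levelValue su2Rep L β 0 ^ 2 *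
          l2 (dressedLiftVec β (Ω : GaugeConfig 3 L SU2 → ℝ) (g i)) (dressedLiftVec β (Ω : GaugeConfig 3 L SU2 → ℝ) (g i)) := by
    intro i
    obtain ⟨a', ha'⟩ := residualLaw_allBases_of_reference_lift_width β (fun G => dressedLiftVec β (Ω : GaugeConfig 3 L SU2 → ℝ) G)
      (fun f c' hf => dressedLiftVec_sum_smul' β hΩphys f c' hf) (fun G hG' => isPhys_dressedLiftVec β hΩphys hG')
      hB k hΩ₁ ⟨c₁, hc₁, hc₁le⟩ hψ hon ev heig hΛ₁ hΛ₁k hdom₁ (fun n => μ (j₀ n)) hρ hγ hNγ hres hwidth hgram hb i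
    exact ⟨a', ha'.trans (mul_le_mul_of_nonneg_right hrate (l2_self_nonneg _))⟩
  have hΩclause : LeakageClause k C β (dressedLiftFamily β (Ω : GaugeConfig 3 L SU2 → ℝ) g) :=
    leakageClause_dressed_of_residual C β hΩphys hb.2.2.2.2.1 hres_all
  exact (leakageClause_iterate_iff hV hφ (dressSteps L) C g).2 hΩclause

end Summit.QuantumFields.YangMills.Theorems.FemtoTransferGap.LiftLeak

end
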